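import Mathlib
import Summits.Ventures.HodgeRepro.Tier4.Line4.CentreWeights

/-!
# Tier4/Line4/WallDataOfIntegers — the wall's `R : RTFData` with `_hR`, `compT`, `compT'` AND all twelve character
binders, from the integers (C-L4-B-EXTEND, part 10: the (B) row packaged as the wall's torus data)

Blind re-derivation cell `pub-hodge-repro`, Tier 4 «prove the step» (README §9–§10), seat t4-x2 (reserve
wall-breaker, gen 6; GO S16576).  Tree path `lean/Summits/Ventures/HodgeRepro/Tier4/Line4/WallDataOfIntegers.lean`.
Imports: Mathlib + `Tier4/Line4/CentreWeights` (the chain parts 1–9; through it L4-p2's TorusCocompactAniso p718934: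
`exists_rtfData_isHaar_closure_of_anisotropic`).  No definition, no instance, no printed theorem proved.

* **`exists_rtfData_of_integers_seesaw`** — on LINE L4's seesaw plane, from the integers `(eP, eM, eP′, eM′)` with
  `eP w + eM w = eP′ w + eM′ w` (`hsum`) and the general position `hgen`, modulo the print [DE14] Cor. 3.6.2 (`hDE`,
  `hDE'`) and p723452's `hcl`/`hbot`: an `R : RTFData` whose measures are Haar (`_hR`), whose fundamental domains are
  measurable and relatively compact (`compT`, `compT'`), and whose characters carry the wall's `_hunit'`, `_hchi`,
  `_hchi'`, `hc`, `hu`, `hc'` — the wall's binders `R _hR _hunit' _hchi _hchi' hc hu hc' compT compT'` in ONE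
  existential (the pair of part 9b fed to L4-p2's `exists_rtfData_isHaar_closure_of_anisotropic`).
What the wall still asks beyond this: `μ DG fdG compG` (half (C), p719074 modulo the BHC print), `h4bC` (p717672),
`hA` (SeesawAnisotropic), `_he`/`_he'` and WHICH integers (the face's identity), and the displays (7a)/(7b)/(8).
Nothing here says anything about the status of the Hodge conjecture for CM abelian varieties, which is NOT proved;
HC_CM is NOT proved by anyone in this repository.
-/

set_option autoImplicit false

noncomputable section

namespace Summit.Ventures.HodgeRepro.Tier4.Line4

open NumberField Matrix MeasureTheory Summit.Ventures.HodgeRepro.Tier4.Common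
  Summit.Ventures.HodgeRepro.Tier4.Line1 Summit.Ventures.HodgeRepro.Tier4.Lit

section WallData

variable {k : Type} [Field k] [NumberField k] (q : QuadData k) (a : Fin 4 → k)
  (g g' : Matrix (Fin 4) (Fin 4) k) (hgg' : g * g' = 1) (hg'g : g' * g = 1)
  (hgΩ : g * (PlaneData.mixedRow q (a 0) (a 2)).Ω = (PlaneData.mixedRow q (a 0) (a 2)).Ω * g)
  (lam : k) (hlam : lam ≠ 0)
  (hiso : g * (PlaneData.mixedRow q (a 1) (a 3)).B * gᵀ = lam • (PlaneData.mixedRow q (a 0) (a 2)).B)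

include lam hlam hiso in
/-- **THE WALL'S TORUS DATA FROM THE INTEGERS**: `R : RTFData` on the seesaw plane with Haar torus measures, measurable
relatively compact fundamental domains, and characters with the wall's `_hunit'`, `_hchi`, `_hchi'`, `hc`, `hu`,
`hc'` — from `(eP, eM, eP′, eM′)` with `hsum`, modulo the print (twice), `hcl`/`hbot` and `hgen`. -/
theorem exists_rtfData_of_integers_seesaw
    [MeasurableSpace (GA ((PlaneData.mixedRow q (a 0) (a 2)).withTransportedTorus g g' hgg' hg'g hgΩ))]
    [BorelSpace (GA ((PlaneData.mixedRow q (a 0) (a 2)).withTransportedTorus g g' hgg' hg'g hgΩ))]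
    (ht : q.t = 0) (hn : ¬ IsSquare (-q.n)) (ha : ∀ i, a i ≠ 0)
    (hreal : ∀ w : InfinitePlace k, w.IsReal) (hcm : ∀ w, IsCMAt q w)
    (hA : IsAnisotropic ((PlaneData.mixedRow q (a 0) (a 2)).withTransportedTorus g g' hgg' hg'g hgΩ))
    [hcl : IsClosed ((rationalOf ((PlaneData.mixedRow q (a 0) (a 2)).withTransportedTorus g g' hgg' hg'g hgΩ)
      (torusT ((PlaneData.mixedRow q (a 0) (a 2)).withTransportedTorus g g' hgg' hg'g hgΩ)) :
      Subgroup (torusT ((PlaneData.mixedRow q (a 0) (a 2)).withTransportedTorus g g' hgg' hg'g hgΩ))) :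
      Set (torusT ((PlaneData.mixedRow q (a 0) (a 2)).withTransportedTorus g g' hgg' hg'g hgΩ)))]
    (hbot : rationalOf ((PlaneData.mixedRow q (a 0) (a 2)).withTransportedTorus g g' hgg' hg'g hgΩ)
      (torusT ((PlaneData.mixedRow q (a 0) (a 2)).withTransportedTorus g g' hgg' hg'g hgΩ)) ⊓
      torusInf ((PlaneData.mixedRow q (a 0) (a 2)).withTransportedTorus g g' hgg' hg'g hgΩ) = ⊥)
    (hDE : letI : CommGroup (torusT ((PlaneData.mixedRow q (a 0) (a 2)).withTransportedTorus g g' hgg' hg'g hgΩ)) :=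
        { (inferInstance : Group (torusT ((PlaneData.mixedRow q (a 0) (a 2)).withTransportedTorus g g' hgg' hg'g hgΩ)))
          with mul_comm := torusT_seesaw_mul_comm q a g g' hgg' hg'g hgΩ (ha 0) (ha 2) }
      haveI : CompactSpace (torusT ((PlaneData.mixedRow q (a 0) (a 2)).withTransportedTorus g g' hgg' hg'g hgΩ) ⧸
          rationalOf ((PlaneData.mixedRow q (a 0) (a 2)).withTransportedTorus g g' hgg' hg'g hgΩ)
            (torusT ((PlaneData.mixedRow q (a 0) (a 2)).withTransportedTorus g g' hgg' hg'g hgΩ))) :=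
        compactSpace_quotient_of_cocompact _ (cocompact_rationalOf_torusT_of_anisotropic _
          (isGenuineRow_seesawPlane q ht hn a (ha 0) (ha 2) g g' hgg' hg'g hgΩ lam hlam hiso) hA)
      DeitmarEchterhoff2014_Cor_3_6_2_restriction_surjective
        (torusT ((PlaneData.mixedRow q (a 0) (a 2)).withTransportedTorus g g' hgg' hg'g hgΩ) ⧸
          rationalOf ((PlaneData.mixedRow q (a 0) (a 2)).withTransportedTorus g g' hgg' hg'g hgΩ)
            (torusT ((PlaneData.mixedRow q (a 0) (a 2)).withTransportedTorus g g' hgg' hg'g hgΩ))))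
    (hDE' : letI : CommGroup (torusT' ((PlaneData.mixedRow q (a 0) (a 2)).withTransportedTorus g g' hgg' hg'g hgΩ)) :=
        { (inferInstance : Group (torusT' ((PlaneData.mixedRow q (a 0) (a 2)).withTransportedTorus g g' hgg' hg'g hgΩ)))
          with mul_comm := torusT'_seesaw_mul_comm q a g g' hgg' hg'g hgΩ lam hlam hiso (ha 1) (ha 3) }
      haveI : IsClosed ((rationalOf ((PlaneData.mixedRow q (a 0) (a 2)).withTransportedTorus g g' hgg' hg'g hgΩ)
          (torusT' ((PlaneData.mixedRow q (a 0) (a 2)).withTransportedTorus g g' hgg' hg'g hgΩ)) :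
          Subgroup (torusT' ((PlaneData.mixedRow q (a 0) (a 2)).withTransportedTorus g g' hgg' hg'g hgΩ))) :
          Set (torusT' ((PlaneData.mixedRow q (a 0) (a 2)).withTransportedTorus g g' hgg' hg'g hgΩ))) :=
        isClosed_rationalOf_torusT' _
      haveI : CompactSpace (torusT' ((PlaneData.mixedRow q (a 0) (a 2)).withTransportedTorus g g' hgg' hg'g hgΩ) ⧸
          rationalOf ((PlaneData.mixedRow q (a 0) (a 2)).withTransportedTorus g g' hgg' hg'g hgΩ)
            (torusT' ((PlaneData.mixedRow q (a 0) (a 2)).withTransportedTorus g g' hgg' hg'g hgΩ))) :=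
        compactSpace_quotient_of_cocompact _ (cocompact_rationalOf_torusT'_of_anisotropic _
          (isGenuineRow_seesawPlane q ht hn a (ha 0) (ha 2) g g' hgg' hg'g hgΩ lam hlam hiso) hA)
      DeitmarEchterhoff2014_Cor_3_6_2_restriction_surjective
        (torusT' ((PlaneData.mixedRow q (a 0) (a 2)).withTransportedTorus g g' hgg' hg'g hgΩ) ⧸
          rationalOf ((PlaneData.mixedRow q (a 0) (a 2)).withTransportedTorus g g' hgg' hg'g hgΩ)
            (torusT' ((PlaneData.mixedRow q (a 0) (a 2)).withTransportedTorus g g' hgg' hg'g hgΩ))))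
    (eP eM eP' eM' : InfinitePlace k → ℤ) (hsum : ∀ w, eP w + eM w = eP' w + eM' w)
    (hgen : ∀ t : GA ((PlaneData.mixedRow q (a 0) (a 2)).withTransportedTorus g g' hgg' hg'g hgΩ),
      t ∈ torusT ((PlaneData.mixedRow q (a 0) (a 2)).withTransportedTorus g g' hgg' hg'g hgΩ) →
      t ∈ torusT' ((PlaneData.mixedRow q (a 0) (a 2)).withTransportedTorus g g' hgg' hg'g hgΩ) →
      t ∈ infinitePart ((PlaneData.mixedRow q (a 0) (a 2)).withTransportedTorus g g' hgg' hg'g hgΩ) →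
      t ∈ centre ((PlaneData.mixedRow q (a 0) (a 2)).withTransportedTorus g g' hgg' hg'g hgΩ)) :
    ∃ R : RTFData ((PlaneData.mixedRow q (a 0) (a 2)).withTransportedTorus g g' hgg' hg'g hgΩ),
      R.IsHaar ∧ MeasurableSet R.DT ∧ MeasurableSet R.DT' ∧ IsCompact (closure R.DT) ∧ IsCompact (closure R.DT') ∧
      (∀ t, ‖R.chi' t‖ = 1) ∧
      (∀ w : InfinitePlace k, ChiMatchesAt ((PlaneData.mixedRow q (a 0) (a 2)).withTransportedTorus g g' hgg' hg'g hgΩ)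
        q w (eP w) (eM w) R.chi) ∧
      (∀ w : InfinitePlace k, ChiMatchesAt' ((PlaneData.mixedRow q (a 0) (a 2)).withTransportedTorus g g' hgg' hg'g hgΩ)
        q w g g' (eP' w) (eM' w) R.chi') ∧
      Continuous R.chi ∧ (∀ t, ‖R.chi t‖ = 1) ∧ Continuous R.chi' := by
  obtain ⟨chi, chi', hmul, hrat, hcont, hunit, hchi, hmul', hrat', hcont', hunit', hchi', hcentre⟩ :=
    exists_wall_character_pair_seesaw_of_sum q a g g' hgg' hg'g hgΩ lam hlam hiso ht hn ha hreal hcm hA hbot hDE hDE'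
      eP eM eP' eM' hsum hgen
  have hrat2 : ∀ t : torusT ((PlaneData.mixedRow q (a 0) (a 2)).withTransportedTorus g g' hgg' hg'g hgΩ),
      (t : GA _) ∈ rationalPoints ((PlaneData.mixedRow q (a 0) (a 2)).withTransportedTorus g g' hgg' hg'g hgΩ) →
      chi t = 1 := by
    intro t ht'
    apply hrat
    rw [rationalOf, Subgroup.mem_subgroupOf]
    exact ht'
  have hrat2' : ∀ t : torusT' ((PlaneData.mixedRow q (a 0) (a 2)).withTransportedTorus g g' hgg' hg'g hgΩ),
      (t : GA _) ∈ rationalPoints ((PlaneData.mixedRow q (a 0) (a 2)).withTransportedTorus g g' hgg' hg'g hgΩ) →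
      chi' t = 1 := by
    intro t ht'
    apply hrat'
    rw [rationalOf, Subgroup.mem_subgroupOf]
    exact ht'
  obtain ⟨R, hRchi, hRchi', hRhaar, hDT, hDT', hcT, hcT'⟩ :=
    exists_rtfData_isHaar_closure_of_anisotropic ((PlaneData.mixedRow q (a 0) (a 2)).withTransportedTorus g g' hgg' hg'g hgΩ)
      (isGenuineRow_seesawPlane q ht hn a (ha 0) (ha 2) g g' hgg' hg'g hgΩ lam hlam hiso) hA chi chi' hmul hmul'
      hrat2 hrat2' hcentre
  refine ⟨R, hRhaar, hDT, hDT', hcT, hcT', ?_, ?_, ?_, ?_, ?_, ?_⟩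
  · rw [hRchi']; exact hunit'
  · rw [hRchi]; exact hchi
  · rw [hRchi']; exact hchi'
  · rw [hRchi]; exact hcont
  · rw [hRchi]; exact hunit
  · rw [hRchi']; exact hcont'

end WallData

end Summit.Ventures.HodgeRepro.Tier4.Line4

end
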